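/-
Copyright (c) 2026 the pub-hodgecm-mathlib formalisation cell (harness21).  Prover seat hodgecm-mathlib-F0P3a-p02 (g17): road «S3-ram» (junction heir F0P3a-p01 (g17): the
engine runs in the J₀-model, the finite-field censuses ★ p847132∕p847196∕p847208∕p847236∕p847254 are typed in the diagonal model — this is the change-of-frame bridge); 2026-09-02.
-/
import Mathlib
import HarnessLib

/-!
# Counting vectors by the values of two quadratic forms is invariant under a change of frame: `x ↦ A·x` carries `(ᵗA G A, A⁻¹ Y A)` to `(G, Y)`
# (Serre, *A Course in Arithmetic*, Ch. IV §1; Ireland–Rosen Ch. 8)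

Topic `LinearAlgebra`; namespace `Literature.LinearAlgebra.QuadraticFormCountCongruence`.  THEOREMS ONLY (no definition, no instance, no notation, no named fact, no `sorry`);
Mathlib only.  Written for the cell `pub/hodgecm-mathlib` (crux H413, `--supports stmt-HodgeConjecture-24833`, road «S3-ram»): the residual censuses of the ramified type-(1)
literals (null isotropic lines `#{x̄ : ᵗx̄Gx̄ = 0 ∧ ᵗx̄GȲx̄ = 0}`, class splits `#{… ∧ χ(c·ᵗx̄GȲx̄) = σ}`) are typed in the DIAGONAL frame (`G = diag d`, ★
`DepthZeroKappaTransferTypeOneRamifiedRootTwists` ∕ `…RootClassSum` ∕ `…AxisTwists` ∕ `…AxisEndTwists`, coordinates `k × k × k`), while the junction's tree engine runs in the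
`J₀`-frame (`G = antidiag(1,1,1)`, ★ `OrthogonalThreeNullIsotropicParamsCount` & co., coordinates `Fin 3 → k`).  For an invertible `A` with `G′ = ᵗA·G·A` and `Y′ = A⁻¹·Y·A`:
`ᵗx G′ x = ᵗ(Ax) G (Ax)` and `ᵗx (G′Y′) x = ᵗ(Ax) (GY) (Ax)`, so `x ↦ Ax` is a bijection matching both values — every count ∕ character sum defined through the pair of values
`(ᵗxGx, ᵗxGYx)` agrees in the two frames (§1), the zero vector corresponding to itself (§1, `x ≠ 0` versions); §2 is the coordinate bridge `k × k × k ≃ (Fin 3 → k)`.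
HONEST LABEL: HC_CM is proved only modulo the 2 remaining named inputs (hLiu418 24832, h413 24833) until rung 0 closes; nothing printed is asserted here (linear algebra).

* §1 `dotProduct_congr_mulVec`, `dotProduct_congr_mul_conj_mulVec` (the two value identities), **`sum_congr_frame_eq`** (`Σ_x f(ᵗxG′x, ᵗxG′Y′x) = Σ_x f(ᵗxGx, ᵗxGYx)`),
  **`card_filter_congr_frame_eq`**, **`ncard_setOf_ne_zero_congr_frame_eq`** (the `x ≠ 0` set version in ★ `OrthogonalThreeNullIsotropicParamsCount` currency).
* §2 `sum_prod_three_eq_sum_fin_three` (`Σ_{v : k × k × k} f(v.1, v.2.1, v.2.2) = Σ_{w : Fin 3 → k} f(w 0, w 1, w 2)`), `card_filter_prod_three_eq_card_filter_fin_three`.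

## References
* [Serre1973] J.-P. Serre, *A Course in Arithmetic*, GTM 7, Ch. IV §1.1–§1.6 (equivalent quadratic forms; change of basis `X ↦ ᵗAXA`).
* [IrelandRosen1990] K. Ireland, M. Rosen, *A Classical Introduction to Modern Number Theory*, GTM 84, Ch. 8 §1 (counting solutions over finite fields).
-/

set_option autoImplicit false

namespace Literature.LinearAlgebra.QuadraticFormCountCongruence

open Finset Matrix

variable {k : Type*}

/-! ## §1 Change of frame -/

section Frame

variable [CommRing k] {n : ℕ}

/-- `ᵗx (ᵗA G A) x = ᵗ(Ax) G (Ax)`. [cite: Serre1973, Ch. IV §1.6] -/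
theorem dotProduct_congr_mulVec (A G : Matrix (Fin n) (Fin n) k) (x : Fin n → k) :
    x ⬝ᵥ ((Aᵀ * G * A) *ᵥ x) = (A *ᵥ x) ⬝ᵥ (G *ᵥ (A *ᵥ x)) := by
  rw [← Matrix.mulVec_mulVec, ← Matrix.mulVec_mulVec, Matrix.dotProduct_mulVec, Matrix.vecMul_transpose]

/-- `ᵗx (ᵗA G A · A⁻¹ Y A) x = ᵗ(Ax) (G Y) (Ax)` for invertible `A`. [cite: Serre1973, Ch. IV §1.6] -/
theorem dotProduct_congr_mul_conj_mulVec (A : GL (Fin n) k) (G Y : Matrix (Fin n) (Fin n) k) (x : Fin n → k) :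
    x ⬝ᵥ ((((A : Matrix (Fin n) (Fin n) k))ᵀ * G * (A : Matrix (Fin n) (Fin n) k) *
        (((A⁻¹ : GL (Fin n) k) : Matrix (Fin n) (Fin n) k) * Y * (A : Matrix (Fin n) (Fin n) k))) *ᵥ x) =
      ((A : Matrix (Fin n) (Fin n) k) *ᵥ x) ⬝ᵥ ((G * Y) *ᵥ ((A : Matrix (Fin n) (Fin n) k) *ᵥ x)) := by
  have hAA : (A : Matrix (Fin n) (Fin n) k) * ((A⁻¹ : GL (Fin n) k) : Matrix (Fin n) (Fin n) k) = 1 := by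
    rw [← Units.val_mul, mul_inv_cancel, Units.val_one]
  have hprod : ((A : Matrix (Fin n) (Fin n) k))ᵀ * G * (A : Matrix (Fin n) (Fin n) k) * (((A⁻¹ : GL (Fin n) k) : Matrix (Fin n) (Fin n) k) * Y * (A : Matrix (Fin n) (Fin n) k)) =
      ((A : Matrix (Fin n) (Fin n) k))ᵀ * (G * Y) * (A : Matrix (Fin n) (Fin n) k) := by
    calc ((A : Matrix (Fin n) (Fin n) k))ᵀ * G * (A : Matrix (Fin n) (Fin n) k) * (((A⁻¹ : GL (Fin n) k) : Matrix (Fin n) (Fin n) k) * Y * (A : Matrix (Fin n) (Fin n) k))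
        = ((A : Matrix (Fin n) (Fin n) k))ᵀ * G * ((A : Matrix (Fin n) (Fin n) k) * ((A⁻¹ : GL (Fin n) k) : Matrix (Fin n) (Fin n) k)) * Y * (A : Matrix (Fin n) (Fin n) k) := by
          simp only [Matrix.mul_assoc]
      _ = ((A : Matrix (Fin n) (Fin n) k))ᵀ * (G * Y) * (A : Matrix (Fin n) (Fin n) k) := by rw [hAA, Matrix.mul_one, Matrix.mul_assoc _ G Y]
  rw [hprod, dotProduct_congr_mulVec]

/-- **CHANGE OF FRAME FOR NON-ZERO COUNTS** (the `Set.ncard` ∕ `x ≠ 0` currency of ★ `OrthogonalThreeNullIsotropicParamsCount`): the zero vector corresponds to itself under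
`x ↦ Ax`, so the counts of NON-ZERO vectors with prescribed `(ᵗxGx, ᵗxGYx)`-behaviour also agree. [cite: Serre1973, Ch. IV §1.6] [cite: IrelandRosen1990, Ch. 8 §1] -/
theorem ncard_setOf_ne_zero_congr_frame_eq (A : GL (Fin n) k) (G Y : Matrix (Fin n) (Fin n) k) (P : k → k → Prop) :
    {x : Fin n → k | x ≠ 0 ∧ P (x ⬝ᵥ ((((A : Matrix (Fin n) (Fin n) k))ᵀ * G * (A : Matrix (Fin n) (Fin n) k)) *ᵥ x))
        (x ⬝ᵥ ((((A : Matrix (Fin n) (Fin n) k))ᵀ * G * (A : Matrix (Fin n) (Fin n) k) *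
          (((A⁻¹ : GL (Fin n) k) : Matrix (Fin n) (Fin n) k) * Y * (A : Matrix (Fin n) (Fin n) k))) *ᵥ x))}.ncard =
      {x : Fin n → k | x ≠ 0 ∧ P (x ⬝ᵥ (G *ᵥ x)) (x ⬝ᵥ ((G * Y) *ᵥ x))}.ncard := by
  classical
  have hinv : ∀ x : Fin n → k, ((A⁻¹ : GL (Fin n) k) : Matrix (Fin n) (Fin n) k) *ᵥ ((A : Matrix (Fin n) (Fin n) k) *ᵥ x) = x := fun x => by
    rw [Matrix.mulVec_mulVec, ← Units.val_mul, inv_mul_cancel, Units.val_one, Matrix.one_mulVec]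
  have hinv' : ∀ x : Fin n → k, (A : Matrix (Fin n) (Fin n) k) *ᵥ (((A⁻¹ : GL (Fin n) k) : Matrix (Fin n) (Fin n) k) *ᵥ x) = x := fun x => by
    rw [Matrix.mulVec_mulVec, ← Units.val_mul, mul_inv_cancel, Units.val_one, Matrix.one_mulVec]
  have himage : {x : Fin n → k | x ≠ 0 ∧ P (x ⬝ᵥ (G *ᵥ x)) (x ⬝ᵥ ((G * Y) *ᵥ x))} =
      (fun x => (A : Matrix (Fin n) (Fin n) k) *ᵥ x) ''
        {x : Fin n → k | x ≠ 0 ∧ P (x ⬝ᵥ ((((A : Matrix (Fin n) (Fin n) k))ᵀ * G * (A : Matrix (Fin n) (Fin n) k)) *ᵥ x))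
          (x ⬝ᵥ ((((A : Matrix (Fin n) (Fin n) k))ᵀ * G * (A : Matrix (Fin n) (Fin n) k) *
            (((A⁻¹ : GL (Fin n) k) : Matrix (Fin n) (Fin n) k) * Y * (A : Matrix (Fin n) (Fin n) k))) *ᵥ x))} := by
    ext y
    simp only [Set.mem_setOf_eq, Set.mem_image]
    constructor
    · rintro ⟨hy, hP⟩
      refine ⟨((A⁻¹ : GL (Fin n) k) : Matrix (Fin n) (Fin n) k) *ᵥ y, ⟨fun h0 => hy ?_, ?_⟩, hinv' y⟩
      · rw [← hinv' y, h0, Matrix.mulVec_zero]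
      · rw [dotProduct_congr_mulVec, dotProduct_congr_mul_conj_mulVec, hinv']
        exact hP
    · rintro ⟨x, ⟨hx, hP⟩, rfl⟩
      refine ⟨fun h0 => hx ?_, ?_⟩
      · rw [← hinv x, h0, Matrix.mulVec_zero]
      · rw [dotProduct_congr_mulVec, dotProduct_congr_mul_conj_mulVec] at hP
        exact hP
  rw [himage, Set.ncard_image_of_injective _ (fun x y hxy => by simpa [hinv] using congrArg (fun z => ((A⁻¹ : GL (Fin n) k) : Matrix (Fin n) (Fin n) k) *ᵥ z) hxy)]

variable [Fintype k]

/-- **CHANGE OF FRAME FOR SUMS.**  For invertible `A`, `G′ = ᵗAGA`, `Y′ = A⁻¹YA` and any `f`: `Σ_x f(ᵗxG′x, ᵗxG′Y′x) = Σ_x f(ᵗxGx, ᵗxGYx)` (the bijection `x ↦ Ax`).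
[cite: Serre1973, Ch. IV §1.6] [cite: IrelandRosen1990, Ch. 8 §1] -/
theorem sum_congr_frame_eq {β : Type*} [AddCommMonoid β] (A : GL (Fin n) k) (G Y : Matrix (Fin n) (Fin n) k) (f : k → k → β) :
    ∑ x : Fin n → k, f (x ⬝ᵥ ((((A : Matrix (Fin n) (Fin n) k))ᵀ * G * (A : Matrix (Fin n) (Fin n) k)) *ᵥ x))
        (x ⬝ᵥ ((((A : Matrix (Fin n) (Fin n) k))ᵀ * G * (A : Matrix (Fin n) (Fin n) k) *
          (((A⁻¹ : GL (Fin n) k) : Matrix (Fin n) (Fin n) k) * Y * (A : Matrix (Fin n) (Fin n) k))) *ᵥ x)) =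
      ∑ x : Fin n → k, f (x ⬝ᵥ (G *ᵥ x)) (x ⬝ᵥ ((G * Y) *ᵥ x)) := by
  have hinv : ∀ x : Fin n → k, ((A⁻¹ : GL (Fin n) k) : Matrix (Fin n) (Fin n) k) *ᵥ ((A : Matrix (Fin n) (Fin n) k) *ᵥ x) = x := fun x => by
    rw [Matrix.mulVec_mulVec, ← Units.val_mul, inv_mul_cancel, Units.val_one, Matrix.one_mulVec]
  have hinv' : ∀ x : Fin n → k, (A : Matrix (Fin n) (Fin n) k) *ᵥ (((A⁻¹ : GL (Fin n) k) : Matrix (Fin n) (Fin n) k) *ᵥ x) = x := fun x => by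
    rw [Matrix.mulVec_mulVec, ← Units.val_mul, mul_inv_cancel, Units.val_one, Matrix.one_mulVec]
  refine Fintype.sum_equiv ⟨fun x => (A : Matrix (Fin n) (Fin n) k) *ᵥ x, fun x => ((A⁻¹ : GL (Fin n) k) : Matrix (Fin n) (Fin n) k) *ᵥ x, hinv, hinv'⟩ _ _ (fun x => ?_)
  simp only [Equiv.coe_fn_mk]
  rw [dotProduct_congr_mulVec, dotProduct_congr_mul_conj_mulVec]

/-- **CHANGE OF FRAME FOR COUNTS**: `#{x : P(ᵗxG′x, ᵗxG′Y′x)} = #{x : P(ᵗxGx, ᵗxGYx)}`. [cite: Serre1973, Ch. IV §1.6] [cite: IrelandRosen1990, Ch. 8 §1] -/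
theorem card_filter_congr_frame_eq (A : GL (Fin n) k) (G Y : Matrix (Fin n) (Fin n) k) (P : k → k → Prop) [∀ a b, Decidable (P a b)] :
    (univ.filter fun x : Fin n → k => P (x ⬝ᵥ ((((A : Matrix (Fin n) (Fin n) k))ᵀ * G * (A : Matrix (Fin n) (Fin n) k)) *ᵥ x))
        (x ⬝ᵥ ((((A : Matrix (Fin n) (Fin n) k))ᵀ * G * (A : Matrix (Fin n) (Fin n) k) *
          (((A⁻¹ : GL (Fin n) k) : Matrix (Fin n) (Fin n) k) * Y * (A : Matrix (Fin n) (Fin n) k))) *ᵥ x))).card =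
      (univ.filter fun x : Fin n → k => P (x ⬝ᵥ (G *ᵥ x)) (x ⬝ᵥ ((G * Y) *ᵥ x))).card := by
  rw [Finset.card_filter, Finset.card_filter]
  exact sum_congr_frame_eq A G Y (fun a b => if P a b then 1 else 0)

end Frame

/-! ## §2 The coordinate bridge `k × k × k ≃ (Fin 3 → k)` -/

section Coords

variable [Fintype k]

/-- `Σ_{v : k × k × k} f(v.1, v.2.1, v.2.2) = Σ_{w : Fin 3 → k} f(w 0, w 1, w 2)`. [cite: IrelandRosen1990, Ch. 8 §1] -/
theorem sum_prod_three_eq_sum_fin_three {β : Type*} [AddCommMonoid β] (f : k → k → k → β) :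
    ∑ v : k × k × k, f v.1 v.2.1 v.2.2 = ∑ w : Fin 3 → k, f (w 0) (w 1) (w 2) := by
  refine Fintype.sum_equiv ⟨fun v => ![v.1, v.2.1, v.2.2], fun w => (w 0, w 1, w 2), fun v => ?_, fun w => ?_⟩ _ _ (fun v => ?_)
  · simp
  · ext i; fin_cases i <;> simp
  · simp

/-- `#{v : k × k × k | P(v.1, v.2.1, v.2.2)} = #{w : Fin 3 → k | P(w 0, w 1, w 2)}`. [cite: IrelandRosen1990, Ch. 8 §1] -/
theorem card_filter_prod_three_eq_card_filter_fin_three (P : k → k → k → Prop) [∀ a b c, Decidable (P a b c)] :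
    (univ.filter fun v : k × k × k => P v.1 v.2.1 v.2.2).card = (univ.filter fun w : Fin 3 → k => P (w 0) (w 1) (w 2)).card := by
  rw [Finset.card_filter, Finset.card_filter]
  exact sum_prod_three_eq_sum_fin_three (fun a b c => if P a b c then 1 else 0)

end Coords

end Literature.LinearAlgebra.QuadraticFormCountCongruence
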